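import Literature.NumberTheory.Automorphic.AutomorphicRepsGL
import HarnessLib

/-!
# C- versus L-algebraicity for `GL_n`: dependence on the parity of `n` (Buzzard–Gee)

For an automorphic representation `π` of `GL_n(𝔸_K)` the tree has two algebraicity *predicates*
(definitions, not theorems): `AutomorphicRepData.IsCAlgebraic π` — Clozel's "algébrique"
(Clozel 1990, Déf. 1.8), Buzzard–Gee's "C-algebraic" (Buzzard–Gee 2014, Def. 3.1.2): all
archimedean exponents lie in `(n-1)/2 + ℤ` — and `AutomorphicRepData.IsLAlgebraic π`
(Buzzard–Gee 2014, Def. 3.1.1: all exponents in `ℤ`), both read off an infinity type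
`T : InfinityType K n` (`InfinityType.IsCAlgebraic`, `InfinityType.IsLAlgebraic`).

Neither predicate holds for every `π`: Buzzard–Gee 2014, §3.1 (p. 13 of arXiv:1009.0785):
"the trivial 1-dimensional representation of `GL₂(𝔸_ℚ)` is C-algebraic but not L-algebraic,
whereas the representation `|det|^{1/2}` of `GL₂(𝔸_ℚ)` is L-algebraic but not C-algebraic …
they coincide for `GL_n` over a number field if `n` is odd, and differ by a non-trivial twist if
`n` is even." This file proves exactly that parity remark, on infinity types and (for odd `n`)
on automorphic representation data:

* `InfinityType.IsLAlgebraic.twist_intCast`, `InfinityType.isLAlgebraic_twist_intCast_iff`: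
  L-algebraicity is invariant under the twist by an *integral* power `|det|^m`.
* `InfinityType.isCAlgebraic_iff_isLAlgebraic_of_odd`: for odd `n`, C-algebraic ↔ L-algebraic
  (`(n-1)/2 ∈ ℤ`, "half the sum of the positive roots is in the weight lattice").
* `InfinityType.isCAlgebraic_iff_isLAlgebraic_twist_half_of_even`: for even `n`,
  `T` is C-algebraic ↔ `T ⊗ |det|^{1/2}` is L-algebraic.
* `InfinityType.IsCAlgebraic.not_isLAlgebraic_of_even`: for even `n` an infinity type with at
  least one weight is never both (no complex number lies in `ℤ ∩ (½ + ℤ)`).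
* `AutomorphicRepData.isCAlgebraic_iff_isLAlgebraic_of_odd`: for odd `n`,
  `π.IsCAlgebraic ↔ π.IsLAlgebraic`.

What is NOT here: the statement "`π` C-algebraic ↔ `π ⊗ |det|^{1/2}` L-algebraic" for even `n`
at the level of `AutomorphicRepData` (it needs the infinity type of a twist, i.e. an archimedean
computation on `HasArchParameter`, not attempted), and any claim that a given `π` *is*
C-algebraic (that is a property of `π`, e.g. of cohomological representations,
`HasWeightZero.isRegularAlgebraic`).

## References

* K. Buzzard, T. Gee, *The conjectural connections between automorphic representations and
  Galois representations*, in: Automorphic Forms and Galois Representations 1, LMS Lecture Note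
  Ser. 414 (2014), §2.3 (Def. 2.3.3 and the remark "if `δ ∈ X^*(T)` the notions coincide"),
  §3.1 (Def. 3.1.1, 3.1.2 and the `GL_n` parity remark), §5.3; arXiv:1009.0785.
* L. Clozel, *Motifs et formes automorphes: applications du principe de fonctorialité*, in:
  Automorphic forms, Shimura varieties, and L-functions I, Perspect. Math. 10 (1990), Déf. 1.8.
-/

-- (H5) the place subtypes indexing the factors of `mixedSpace K` use classical `Fintype` instances
open scoped Classical

namespace Literature.NumberTheory.Automorphic

namespace InfinityType

variable {K : Type*} [Field K] {n : ℕ}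

/-- Twisting an infinity type by `|det|^0` does nothing. Buzzard–Gee 2014, §3.1. [cite: BuzzardGee2014, §3.1] -/
@[simp] theorem twist_zero (T : InfinityType K n) : T.twist 0 = T := by
  funext σ
  simp

/-- L-algebraicity is preserved by the twist `T ⊗ |det|^m` for an *integer* `m`: the exponents
`(a, b)` become `(a + m, b + m)`. Buzzard–Gee 2014, §3.1 (and §5.3). [cite: BuzzardGee2014, §3.1] -/
theorem IsLAlgebraic.twist_intCast {T : InfinityType K n} (hT : T.IsLAlgebraic) (m : ℤ) :
    (T.twist (m : ℂ)).IsLAlgebraic := by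
  intro σ p hp
  rw [twist_apply, Multiset.mem_map] at hp
  obtain ⟨q, hq, rfl⟩ := hp
  obtain ⟨k, l, hk, hl⟩ := hT σ q hq
  exact ⟨k + m, l + m, by rw [ArchWeight.twist_a, hk]; push_cast; ring,
    by rw [ArchWeight.twist_b, hl]; push_cast; ring⟩

/-- For an integer `m`, `T ⊗ |det|^m` is L-algebraic iff `T` is (twist back by `-m`).
Buzzard–Gee 2014, §3.1. [cite: BuzzardGee2014, §3.1] -/
theorem isLAlgebraic_twist_intCast_iff (T : InfinityType K n) (m : ℤ) :
    (T.twist (m : ℂ)).IsLAlgebraic ↔ T.IsLAlgebraic := by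
  refine ⟨fun h ↦ ?_, fun h ↦ h.twist_intCast m⟩
  have h' := h.twist_intCast (-m)
  rwa [twist_twist, Int.cast_neg, add_neg_cancel, twist_zero] at h'

/-- **Odd `n`: C-algebraic = L-algebraic.** For `GL_n` with `n` odd, half the sum of the positive
roots lies in the weight lattice (`(n-1)/2 ∈ ℤ`), so an infinity type is C-algebraic iff it is
L-algebraic. Buzzard–Gee 2014, §3.1 ("they coincide for `GL_n` over a number field if `n` is
odd"), cf. §2.3. [cite: BuzzardGee2014, §3.1] -/
theorem isCAlgebraic_iff_isLAlgebraic_of_odd (hn : Odd n) (T : InfinityType K n) :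
    T.IsCAlgebraic ↔ T.IsLAlgebraic := by
  obtain ⟨m, rfl⟩ := hn
  have h : (((2 * m + 1 : ℕ) : ℂ) - 1) / 2 = ((m : ℤ) : ℂ) := by push_cast; ring
  rw [isCAlgebraic_iff_isLAlgebraic_twist, h, isLAlgebraic_twist_intCast_iff]

/-- **Even `n`: C- and L-algebraic differ by the twist `|det|^{1/2}`.** For `GL_n` with `n` even,
an infinity type `T` is C-algebraic iff `T ⊗ |det|^{1/2}` is L-algebraic
(`(n-1)/2 ∈ ½ + ℤ`). Buzzard–Gee 2014, §3.1 ("differ by a non-trivial twist if `n` is even")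
and §5.3. [cite: BuzzardGee2014, §3.1] -/
theorem isCAlgebraic_iff_isLAlgebraic_twist_half_of_even (hn : Even n) (T : InfinityType K n) :
    T.IsCAlgebraic ↔ (T.twist (1 / 2 : ℂ)).IsLAlgebraic := by
  obtain ⟨m, rfl⟩ := hn
  have h : (((m + m : ℕ) : ℂ) - 1) / 2 = 1 / 2 + (((m : ℤ) - 1 : ℤ) : ℂ) := by push_cast; ring
  rw [isCAlgebraic_iff_isLAlgebraic_twist, h, ← twist_twist, isLAlgebraic_twist_intCast_iff]

/-- **Even `n`: never both.** For `n` even, an infinity type having at least one weight `p ∈ T σ`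
cannot be both C-algebraic and L-algebraic: `p.a` would lie in `ℤ ∩ (½ + ℤ) = ∅`. (E.g. on
`GL₂(𝔸_ℚ)`: the trivial representation is C- but not L-algebraic, `|det|^{1/2}` is L- but not
C-algebraic.) Buzzard–Gee 2014, §3.1. [cite: BuzzardGee2014, §3.1] -/
theorem IsCAlgebraic.not_isLAlgebraic_of_even (hn : Even n) {T : InfinityType K n}
    (hC : T.IsCAlgebraic) {σ : K →+* ℂ} {p : ArchWeight} (hp : p ∈ T σ) : ¬ T.IsLAlgebraic := by
  intro hL
  obtain ⟨k, -, hk, -⟩ := hC σ p hp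
  obtain ⟨k', -, hk', -⟩ := hL σ p hp
  obtain ⟨m, rfl⟩ := hn
  have h1 : (2 * k + 2 * m - 1 : ℂ) = 2 * k' := by
    have h := hk.symm.trans hk'
    push_cast at h
    linear_combination 2 * h
  have h2 : (2 * k + 2 * (m : ℤ) - 1 : ℤ) = 2 * k' := by exact_mod_cast h1
  omega

/-- For a *well-formed* infinity type (`n` weights at each embedding) with `n` even and
positive, C-algebraic excludes L-algebraic, at any complex embedding `σ` of `K`.
Buzzard–Gee 2014, §3.1. [cite: BuzzardGee2014, §3.1] -/
theorem IsCAlgebraic.not_isLAlgebraic_of_even_of_isWellFormed (hn : Even n) (hn0 : n ≠ 0)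
    {T : InfinityType K n} (hW : T.IsWellFormed) (hC : T.IsCAlgebraic) (σ : K →+* ℂ) :
    ¬ T.IsLAlgebraic := by
  obtain ⟨p, hp⟩ := Multiset.card_pos_iff_exists_mem.mp
    (show 0 < Multiset.card (T σ) by rw [hW.1 σ]; exact Nat.pos_of_ne_zero hn0)
  exact hC.not_isLAlgebraic_of_even hn hp

end InfinityType

namespace AutomorphicRepData

variable {n : ℕ} {K : Type} [Field K] [NumberField K] {hcpt : isCompact_glFiniteIntegralLevel n K}
  (π : AutomorphicRepData (AutomorphyDatum.gl n K hcpt))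

/-- **Odd `n`: a `π` on `GL_n(𝔸_K)` is C-algebraic iff it is L-algebraic** (same infinity type
witnesses both, `InfinityType.isCAlgebraic_iff_isLAlgebraic_of_odd`). Buzzard–Gee 2014, §3.1
("for `GL₃/ℚ` the notions of L-algebraic and C-algebraic coincide again … indeed they coincide
for `GL_n` over a number field if `n` is odd"). [cite: BuzzardGee2014, §3.1] -/
theorem isCAlgebraic_iff_isLAlgebraic_of_odd (hn : Odd n) : π.IsCAlgebraic ↔ π.IsLAlgebraic :=
  exists_congr fun T ↦ and_congr_right fun _ ↦
    InfinityType.isCAlgebraic_iff_isLAlgebraic_of_odd hn T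

/-- For odd `n`, an L-algebraic `π` is C-algebraic. Buzzard–Gee 2014, §3.1. [cite: BuzzardGee2014, §3.1] -/
theorem IsLAlgebraic.isCAlgebraic_of_odd {π : AutomorphicRepData (AutomorphyDatum.gl n K hcpt)}
    (hn : Odd n) (h : π.IsLAlgebraic) : π.IsCAlgebraic :=
  (π.isCAlgebraic_iff_isLAlgebraic_of_odd hn).mpr h

/-- For odd `n`, a C-algebraic `π` is L-algebraic. Buzzard–Gee 2014, §3.1. [cite: BuzzardGee2014, §3.1] -/
theorem IsCAlgebraic.isLAlgebraic_of_odd {π : AutomorphicRepData (AutomorphyDatum.gl n K hcpt)}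
    (hn : Odd n) (h : π.IsCAlgebraic) : π.IsLAlgebraic :=
  (π.isCAlgebraic_iff_isLAlgebraic_of_odd hn).mp h

/-- For even `n`, `π` is C-algebraic iff it has an infinity type `T` whose half-twist
`T ⊗ |det|^{1/2}` is L-algebraic (the infinity-type shadow of "`π` C-algebraic ↔
`π ⊗ |det|^{1/2}` L-algebraic"). Buzzard–Gee 2014, §3.1 and §5.3. [cite: BuzzardGee2014, §3.1 and §5.3] -/
theorem isCAlgebraic_iff_exists_twist_half_of_even (hn : Even n) :
    π.IsCAlgebraic ↔
      ∃ T : InfinityType K n, π.HasInfinityType T ∧ (T.twist (1 / 2 : ℂ)).IsLAlgebraic :=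
  exists_congr fun T ↦ and_congr_right fun _ ↦
    InfinityType.isCAlgebraic_iff_isLAlgebraic_twist_half_of_even hn T

end AutomorphicRepData

end Literature.NumberTheory.Automorphic
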